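import Literature.NumberTheory.LFunctions.TruncatedWeilFormFiniteDictionaryProofs
import Literature.NumberTheory.LFunctions.TruncatedWeilFormZeroSideProofs
import HarnessLib

/-!
# RH-FREE — «nothing here bears on the truth of RH»: Groskin's pole-neutral source survival (arXiv:2607.02828, Corollary 2.7) reduced to the Volterra integral-domain lemma

PROOF LAYER (theorems only, 0 defs, 0 named facts) for the statement file
`Literature/NumberTheory/LFunctions/TruncatedWeilFormFiniteDictionary.lean` (cell `rh-columns/lit`,
rh-lit-frontier-1 gen 2; claim `Groskin2026.corollary_2_7` = A. Groskin, *A finite Guinand–Weil dictionary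
and archimedean tail order for the truncated Weil quadratic form*, arXiv:2607.02828v3, Corollary 2.7,
p. 7–8). Written by seat rh-crit-cc-t4 g5 (surplus seat on the W-C/W-P rung).

The printed proof of Corollary 2.7 has three parts: (a) the dimension count (PROVED by frontier-1,
`corollary_2_7_dim`); (b)/(c) "Finally, `K_v = 2(T_v ∗ T_v)` in the Volterra convolution algebra of
analytic germs at `0`. This algebra is an integral domain … Hence `K_v ≡ 0` implies `T_v = 0`, so `v = 0`.
If `g_v = g_w`, Fourier injectivity gives `K_v = K_w` on `[0,1]`, hence as germs; then
`(T_v − T_w) ∗ (T_v + T_w) = 0`, so `T_v = ±T_w` and `v = ±w`." (p. 8).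

This file PROVES the "Fourier injectivity" step and the bookkeeping, isolating the Volterra step as an
explicit hypothesis (no named fact is introduced):

* `fourierWeight_eq_of_testFunction_eq` — `g_v = g_w ⇒ ĝ_v = ĝ_w` (Mathlib's Fourier inversion
  `Continuous.fourierInv_fourier_eq` over cc-t3's `fourier_fourierWeight : 𝓕 ĝ_v = g_v|ℝ` and
  `integrable_testFunction_real`, the latter resting on this seat's `lemma_2_2_holds`);
* `volterraKernel_eqOn_of_testFunction_eq` — hence `K_v = K_w` on `[0, 1]` (`ĝ_v(Δ(1−ω)) = πK_v(ω)`);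
* `testFunction_zero` — `g_0 = 0`, so clause (b) "`g_v ≠ 0` for `v ≠ 0`" is clause (c) with `w = 0`;
* `corollary_2_7_of_volterra` — **Cor. 2.7 follows from the Volterra integral-domain lemma**
  `∀ N v w, K_v = K_w on [0,1] → v = w ∨ v = −w` (the one remaining analytic input, stated inline as a
  hypothesis; its printed proof is the integral-domain property of the Volterra convolution of analytic
  germs, not yet in the tree).

The source is an unrefereed preprint (`[claim: Groskin2026, status: under-review]`); a kernel proof of
these finite-dimensional statements asserts nothing on its authority. Nothing here bears on Weil
positivity or on the truth of RH.
-/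

noncomputable section

open Filter Set MeasureTheory Complex Finset Matrix
open scoped Real Topology FourierTransform

namespace Literature.NumberTheory.LFunctions

namespace Groskin2026

/-! ### Fourier injectivity: `g_v = g_w ⇒ ĝ_v = ĝ_w ⇒ K_v = K_w` on `[0, 1]` -/

/-- `ĝ_v` is recovered from `g_v|ℝ` by Fourier inversion: `ĝ_v = 𝓕⁻ (g_v|ℝ)`.
[cite: Groskin2026, Corollary 2.7, proof (p. 8): "Fourier injectivity"] -/
theorem fourierWeight_eq_fourierInv {c : ℝ} (hc : 1 < c) (N : ℕ) (v : Fin (N + 1) → ℝ) :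
    fourierWeight c N v = 𝓕⁻ (fun t : ℝ ↦ testFunction c N v t) := by
  have hF : 𝓕 (fourierWeight c N v) = fun t : ℝ ↦ testFunction c N v t :=
    funext (ZeroSide.fourier_fourierWeight hc N v)
  have h := (continuous_fourierWeight hc N v).fourierInv_fourier_eq (integrable_fourierWeight hc N v)
    (by rw [hF]; exact ZeroSide.integrable_testFunction_real hc N v)
  rw [hF] at h
  exact h.symm

/-- **Fourier injectivity**: `g_v = g_w` (as functions on `ℂ`) implies `ĝ_v = ĝ_w`.
[cite: Groskin2026, Corollary 2.7, proof (p. 8)] -/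
theorem fourierWeight_eq_of_testFunction_eq {c : ℝ} (hc : 1 < c) {N : ℕ} {v w : Fin (N + 1) → ℝ}
    (h : testFunction c N v = testFunction c N w) :
    fourierWeight c N v = fourierWeight c N w := by
  rw [fourierWeight_eq_fourierInv hc N v, fourierWeight_eq_fourierInv hc N w, h]

/-- `ĝ_v = ĝ_w` implies `K_v = K_w` on `[0, 1]` (`ĝ_v(Δ(1 − ω)) = π K_v(ω)` for `ω ∈ [0,1]`).
[cite: Groskin2026, Corollary 2.7, proof (p. 8)] -/
theorem volterraKernel_eqOn_of_fourierWeight_eq {c : ℝ} (hc : 1 < c) {N : ℕ}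
    {v w : Fin (N + 1) → ℝ} (h : fourierWeight c N v = fourierWeight c N w) :
    Set.EqOn (volterraKernel N v) (volterraKernel N w) (Set.Icc 0 1) := by
  intro ω hω
  have hΔ := bandwidth_pos hc
  set ξ : ℝ := bandwidth c * (1 - ω) with hξ
  have hξmem : ξ ∈ Set.Icc 0 (bandwidth c) := by
    constructor
    · have : 0 ≤ 1 - ω := by linarith [hω.2]
      positivity
    · have : bandwidth c * (1 - ω) ≤ bandwidth c * 1 := by
        apply mul_le_mul_of_nonneg_left _ hΔ.le; linarith [hω.1]
      simpa [hξ] using this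
  have hωξ : 1 - ξ / bandwidth c = ω := by
    rw [hξ]; field_simp; ring
  have hv := fourierWeight_eq_of_mem_Icc (N := N) (v := v) hξmem
  have hw := fourierWeight_eq_of_mem_Icc (N := N) (v := w) hξmem
  rw [hωξ] at hv hw
  have hπ : (π : ℂ) ≠ 0 := by exact_mod_cast Real.pi_ne_zero
  have := congr_fun h ξ
  rw [hv, hw] at this
  exact mul_left_cancel₀ hπ this

/-- `g_v = g_w` implies `K_v = K_w` on `[0, 1]`. [cite: Groskin2026, Corollary 2.7, proof (p. 8)] -/
theorem volterraKernel_eqOn_of_testFunction_eq {c : ℝ} (hc : 1 < c) {N : ℕ}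
    {v w : Fin (N + 1) → ℝ} (h : testFunction c N v = testFunction c N w) :
    Set.EqOn (volterraKernel N v) (volterraKernel N w) (Set.Icc 0 1) :=
  volterraKernel_eqOn_of_fourierWeight_eq hc (fourierWeight_eq_of_testFunction_eq hc h)

/-! ### The zero vector -/

/-- `u(0) = 0`. [cite: Groskin2026, §2.1 (p. 3)] -/
theorem evenEmbed_zero (N : ℕ) : evenEmbed N (0 : Fin (N + 1) → ℝ) = 0 := by
  funext m
  simp [evenEmbed]

/-- `T_0 = 0`. [cite: Groskin2026, §2.1 (p. 3)] -/
theorem trigPoly_zero (N : ℕ) (t : ℝ) : trigPoly N (0 : Fin (N + 1) → ℝ) t = 0 := by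
  simp [trigPoly, evenEmbed_zero]

/-- `K_0 = 0`. [cite: Groskin2026, §2.1 (p. 3)] -/
theorem volterraKernel_zero_vec (N : ℕ) (ω : ℝ) :
    volterraKernel N (0 : Fin (N + 1) → ℝ) ω = 0 := by
  simp [volterraKernel, trigPoly_zero]

/-- `ĝ_0 = 0`. [cite: Groskin2026, §2.1 (p. 3)] -/
theorem fourierWeight_zero_vec (c : ℝ) (N : ℕ) (ξ : ℝ) :
    fourierWeight c N (0 : Fin (N + 1) → ℝ) ξ = 0 := by
  simp [fourierWeight, volterraKernel_zero_vec]

/-- **`g_0 = 0`**. [cite: Groskin2026, §2.1 (p. 3)] -/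
theorem testFunction_zero (c : ℝ) (N : ℕ) : testFunction c N (0 : Fin (N + 1) → ℝ) = 0 := by
  funext z
  simp [testFunction, fourierWeight_zero_vec]

/-! ### Corollary 2.7 from the Volterra integral-domain lemma -/

/-- **[Gr26] Corollary 2.7 reduced to the Volterra integral-domain lemma.** If for every `N` and all real
`v, w`, `K_v = K_w` on `[0,1]` forces `v = w ∨ v = −w` (printed proof, p. 8: "`K_v = 2(T_v ∗ T_v)` in the
Volterra convolution algebra of analytic germs at `0` … an integral domain … `T_v = ±T_w` and
`v = ±w`"), then Corollary 2.7 holds as typed: (a) is frontier-1's `corollary_2_7_dim`; in (b),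
`g_v(i/2) = 0` is `testFunction_I_half_eq_zero_of_mem_poleNeutral` and `g_v ≠ 0` is (c) against `w = 0`
(`testFunction_zero`); (c) is Fourier injectivity (`volterraKernel_eqOn_of_testFunction_eq`) followed
by the hypothesis. PROVED. [cite: Groskin2026, Corollary 2.7 (p. 7–8)] -/
theorem corollary_2_7_of_volterra
    (hV : ∀ (N : ℕ) (v w : Fin (N + 1) → ℝ),
      Set.EqOn (volterraKernel N v) (volterraKernel N w) (Set.Icc 0 1) → v = w ∨ v = -w) :
    corollary_2_7 := by
  intro c hc N s hN
  refine ⟨(corollary_2_7_dim hc hN).1, ?_, ?_⟩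
  · intro v hv hv0
    refine ⟨?_, testFunction_I_half_eq_zero_of_mem_poleNeutral hc (Submodule.mem_inf.1 hv).2⟩
    intro h0
    have h' : testFunction c N v = testFunction c N (0 : Fin (N + 1) → ℝ) := by
      rw [h0, testFunction_zero]
    rcases hV N v 0 (volterraKernel_eqOn_of_testFunction_eq hc h') with h1 | h1
    · exact hv0 h1
    · exact hv0 (by simpa using h1)
  · intro v w h
    exact hV N v w (volterraKernel_eqOn_of_testFunction_eq hc h)

end Groskin2026

end Literature.NumberTheory.LFunctions

end
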